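import Summits.BirchSwinnertonDyer.BirchSwinnertonDyer.Theorems.EisensteinPrimesAcTwistDeformationLocSurj
import HarnessLib

/-!
# Route `EisensteinPrimes` (rung K5), crux 2 `GoodLatticeBDPValue`, line `halves` v19.1, V21 index road
# input S2 (SUR_f at `v̄`), part 2: the `K_∞`-side global-to-local surjectivity with targets at any
# `S₀ ⊆ S ∖ {v}` FROM THE BARE HYPOTHESIS `SUR(𝐃, 𝓛_v)`, for ANY `p`-primary coefficients `A`
# (helper for stmt-BirchSwinnertonDyer-19032)

Cell `bsd-eis` (home `run/shared/lean/pub/bsd-eis/`), seat `bsd-line-x1-p1-w3` gen 3 (D-0154 width seat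
on crux 2 `GoodLatticeBDPValue`, line `halves` v19.1; LEAD g4's V21 index road
`Cruxes/GoodLatticeBDPValue/Lines/halves-imprimLambda-index-road.md` §4 S2 = SUR_f:
`H¹(K_Σ/K_∞, E[p^∞]) ↠ ⊕_{j<s} H¹(K_{∞,w_j}, E[p^∞])`). The seat's p642242 proved the `K_∞`-side
surjectivity with targets at `S₀ ∋ v̄` for a corank-ONE `A` by feeding LEAD g2's `bigRep_fullAt_SUR`; the
Shapiro-descent half of that proof is coefficient-agnostic. THIS FILE isolates it:
`exists_mem_unramifiedOutside_forall_resOfLe_conjH1_eq_of_SUR` takes Greenberg's `SUR(𝐃, 𝓛_v)` for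
`𝐃 = bigRep κ ρ₀` as a HYPOTHESIS and returns the `K_∞`-side surjectivity for `M ≃ A` — so that S2 for
`A = E[p^∞]` is EXACTLY `SUR(𝐃_E, 𝓛_v)` (Greenberg 2016 Prop. 2.6.3 in the corank-2 arena,
`…AcTwistDeformationCofreeRank`) away.

Theorems only; no definition, no named fact, no `sorry`. HONEST FRAMING: closes nothing by itself
(`--supports`); no summit statement / BSD / IMC2 / KY Thm. 1.4.1 (iii) is proved by this file.
References: [Greenberg2016Selmer] §2.3 (SUR), §1 p. 3; [PollackWeston2011] App. A Prop. A.2;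
[SkinnerUrban2014] §3.1.2, Prop. 3.2.3; [GreenbergVatsal2000] §2 pp. 16–17.
-/

set_option autoImplicit false
set_option linter.dupNamespace false

noncomputable section

open scoped Classical
open NumberField IsDedekindDomain Field Multiplicative PowerSeries
open Literature.NumberTheory.EllipticCurves Literature.NumberTheory.EllipticCurves.GreenbergSelmer
  Literature.NumberTheory.EllipticCurves.GreenbergVatsal2000 Literature.NumberTheory.GaloisRepresentations
  Literature.NumberTheory.EllipticCurves.KellerYin2024 Literature.NumberTheory.EllipticCurves.IwasawaDual
  Literature.NumberTheory.IwasawaTheory Literature.NumberTheory.IwasawaTheory.Greenberg2016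
  Literature.NumberTheory.IwasawaTheory.Greenberg2006
  Summit.BirchSwinnertonDyer.BirchSwinnertonDyer.Theorems.GreenbergFullAtSelmer

namespace Summit.BirchSwinnertonDyer.BirchSwinnertonDyer.Theorems.AcTwistDeformation

section SurOfSUR

variable {K : Type} [Field K] [NumberField K] (S : Set (HeightOneSpectrum (𝓞 K))) {p : ℕ} [Fact p.Prime]
  {A : Type} [AddCommGroup A] [Module ℤ_[p] A] [TopologicalSpace A] [DiscreteTopology A]
  [TopologicalSpace (PowerSeries ℤ_[p])] [IsTopologicalRing (PowerSeries ℤ_[p])]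
  [IsTopologicalAddGroup (BigRepModule ℤ_[p] p A)] [ContinuousSMul (PowerSeries ℤ_[p]) (BigRepModule ℤ_[p] p A)]
  (hS : ∀ v : HeightOneSpectrum (𝓞 K), ((p : ℕ) : 𝓞 K) ∈ v.asIdeal → v ∈ S)
  (κ : ZpExtension K p) (ρ₀ : ContinuousRep (GaloisGroupUnramifiedOutside K S) ℤ_[p] A)
  {M : Type} [AddCommGroup M] [DistribMulAction (absoluteGaloisGroup K) M] [TopologicalSpace M]
  [DiscreteTopology M]
  (ψ : A ≃+ M) (hψ : ∀ (σ : absoluteGaloisGroup K) (a : A), ψ (ρ₀ (toUnramifiedQuot K S σ) a) = σ • ψ a)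

include hψ in
/-- **`K_∞`-SIDE GLOBAL-TO-LOCAL SURJECTIVITY FROM `SUR(𝐃, 𝓛_v)`, ANY COEFFICIENTS.** For the
one-variable twist deformation `𝐃 = A ⊗ Λ^*(κ⁻¹)` (`bigRep κ ρ₀`) of ANY `p`-primary discrete `G_{K,S}`-module
`A` (e.g. `A = E[p^∞]`), identified with the `Γ_K`-module `M` by an equivariant `ψ : A ≃ M`, the Shapiro
descent `F` of `ψ`, and `S ⊇ {w ∣ p}`: IF Greenberg's global-to-local map `φ_{𝓛_v}` (`L_v = ⊤`, `L_w = 0`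
else) is SURJECTIVE (`hSUR`, e.g. `Greenberg2016.prop263_sur_of_crk`), then for every finite `S₀ ⊆ S` of
places `w ≠ v` with `κ(D_w) = p^{a_w} ℤ_p` exactly, representatives `σ_{w,i}` (`κ(σ_{w,i}) = i`,
`i < p^{a_w}`) and ANY targets `y_{w,i} ∈ H¹(ker κ ⊓ D_w, M)`, there is `u ∈ H¹(ker κ, M)` unramified at
every `w ∉ S₀`, `w ∤ p`, locally trivial above every `w ∈ S`, `w ≠ v`, `w ∉ S₀`, with
`res_{ker κ ⊓ D_w}(conj_{σ_{w,i}} u) = y_{w,i}`. This is `exists_mem_unramifiedOutside_forall_resOfLe_conjH1_eq`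
(p642242) with the corank-one inputs of `bigRep_fullAt_SUR` replaced by the bare hypothesis `SUR`: the
descent (local Shapiro surjectivity `exists_localCocycle_forall_eval`, the evaluation classes
`resOfLe_conjH1_shapiroDescent_eq`, the landing lemmas) never used corank one.
[cite: Greenberg2016Selmer, §2.3 p. 7 (SUR) and §1 p. 3] [cite: PollackWeston2011, App. A, Prop. A.2 (proof)]
[cite: SkinnerUrban2014, §3.1.2 and Prop. 3.2.3] -/
theorem exists_mem_unramifiedOutside_forall_resOfLe_conjH1_eq_of_SUR
    {v : HeightOneSpectrum (𝓞 K)} (hv : ((p : ℕ) : 𝓞 K) ∈ v.asIdeal)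
    (hSUR : (fullAtSpecification S (bigRep (κ.liftUnramifiedOutside S hS) ρ₀) (Sum.inr v)).SUR)
    (hA : ∀ a : A, ∃ k : ℕ, p ^ k • a = 0)
    {F : (bigRep (κ.liftUnramifiedOutside S hS) ρ₀).H 1 →+ subgroupH1 κ.kerSubgroup M}
    (hF : ∀ (c : contOneCocycles (bigRep (κ.liftUnramifiedOutside S hS) ρ₀).toTopRep)
      (z : contOneCocycles (discreteTopRep κ.kerSubgroup M)),
      (∀ h : κ.kerSubgroup, z.1 h = ψ ((c.1 (toUnramifiedQuot K S h) : BigRepModule ℤ_[p] p A) 0)) →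
      F (oneCocycleClass _ c) = oneCocycleClass _ z)
    (S₀ : Finset (HeightOneSpectrum (𝓞 K))) (hS₀S : ∀ w ∈ S₀, w ∈ S)
    (hS₀v : ∀ w ∈ S₀, w ≠ v) (a : HeightOneSpectrum (𝓞 K) → ℕ)
    (hdiv : ∀ w ∈ S₀, ∀ δ ∈ decomp (K := K) w, (p : ℤ_[p]) ^ a w ∣ (κ δ).toAdd)
    (hd₀ : ∀ w ∈ S₀, ∃ δ ∈ decomp (K := K) w, (κ δ).toAdd = (p : ℤ_[p]) ^ a w)
    (σrep : HeightOneSpectrum (𝓞 K) → ℕ → absoluteGaloisGroup K)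
    (hσrep : ∀ w ∈ S₀, ∀ i : ℕ, i < p ^ a w → (κ (σrep w i)).toAdd = (i : ℤ_[p]))
    (y : ∀ w : HeightOneSpectrum (𝓞 K), ℕ → subgroupH1 (κ.kerSubgroup ⊓ decomp (K := K) w) M) :
    ∃ u : subgroupH1 κ.kerSubgroup M,
      u ∈ unramifiedOutside κ.kerSubgroup M p (↑S₀ : Set (HeightOneSpectrum (𝓞 K))) ∧
      (∀ w : HeightOneSpectrum (𝓞 K), w ∈ S → w ≠ v → w ∉ S₀ →
        ∀ σ : absoluteGaloisGroup K, conjH1 κ.kerSubgroup M σ u ∈ awayKer κ.kerSubgroup M w) ∧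
      ∀ w ∈ S₀, ∀ i : ℕ, i < p ^ a w →
        resOfLe M (inf_le_left : κ.kerSubgroup ⊓ decomp (K := K) w ≤ κ.kerSubgroup)
          (conjH1 κ.kerSubgroup M (σrep w i) u) = y w i := by
  -- cocycle representatives of the targets
  have hζex : ∀ (w : HeightOneSpectrum (𝓞 K)) (i : ℕ),
      ∃ ζ : contOneCocycles (discreteTopRep ↥(κ.kerSubgroup ⊓ decomp (K := K) w) M),
        oneCocycleClass _ ζ = y w i := fun w i ↦ oneCocycleClass_surjective _ _
  choose ζ hζ using hζex
  -- local cocycles at the places of `S₀` (local Shapiro surjectivity, place-agnostic)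
  have hcls : ∀ w : HeightOneSpectrum (𝓞 K), w ∈ S₀ →
      ∃ c' : contOneCocycles (localRep S (bigRep (κ.liftUnramifiedOutside S hS) ρ₀) (Sum.inr w : Place K)).toTopRep,
        ∀ i : ℕ, i < p ^ a w →
          ∀ (x : ↥(κ.kerSubgroup ⊓ decomp (K := K) w)) (τ : absoluteGaloisGroup (w.adicCompletion K)),
            absGaloisRestrict K (w.adicCompletion K) τ = (x : absoluteGaloisGroup K) →
            (ζ w i).1 x = ψ ((c'.1 τ : BigRepModule ℤ_[p] p A) (i : ℕ)) := fun w hw ↦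
    exists_localCocycle_forall_eval S hS κ ρ₀ ψ hψ hA w (hdiv w hw) (hd₀ w hw) (ζ w)
  choose c' hc' using hcls
  -- the local targets: `[c'_w]` at `w ∈ S₀`, `0` elsewhere
  let xloc : ∀ w : HeightOneSpectrum (𝓞 K),
      (localRep S (bigRep (κ.liftUnramifiedOutside S hS) ρ₀) (Sum.inr w : Place K)).H 1 := fun w ↦
    if hw : w ∈ S₀ then oneCocycleClass _ (c' w hw) else 0
  let xall : ∀ pl : Place K, (localRep S (bigRep (κ.liftUnramifiedOutside S hS) ρ₀) pl).H 1 := fun pl ↦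
    @Sum.rec (InfinitePlace K) (HeightOneSpectrum (𝓞 K))
      (fun pl ↦ (localRep S (bigRep (κ.liftUnramifiedOutside S hS) ρ₀) pl).H 1)
      (fun _ ↦ 0) (fun w ↦ xloc w) pl
  let q : (fullAtSpecification S (bigRep (κ.liftUnramifiedOutside S hS) ρ₀) (Sum.inr v)).QGlobal := fun η ↦
    (fullAtSpecification S (bigRep (κ.liftUnramifiedOutside S hS) ρ₀) (Sum.inr v) η.1).mkQ (xall η.1)
  -- `SUR(𝐃, 𝓛_v)`
  obtain ⟨ξ, hξ⟩ := hSUR q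
  obtain ⟨c, rfl⟩ := oneCocycleClass_surjective _ ξ
  -- the local components of `[c]` at the finite `w ∈ S`, `w ≠ v`
  have hcomp : ∀ w : HeightOneSpectrum (𝓞 K), w ∈ S → w ≠ v →
      loc S (bigRep (κ.liftUnramifiedOutside S hS) ρ₀) (Sum.inr w) 1 (oneCocycleClass _ c) = xloc w := by
    intro w hwS hwv
    have hη := congrFun hξ ⟨Sum.inr w, (inSigma_inr_iff S w).mpr hwS⟩
    simp only [Specification.phi, LinearMap.pi_apply, LinearMap.coe_comp, Function.comp_apply, q, xall] at hη
    rw [Submodule.mkQ_apply, Submodule.mkQ_apply, Submodule.Quotient.eq,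
      fullAtSpecification_of_ne (S := S) (ρ := bigRep (κ.liftUnramifiedOutside S hS) ρ₀)
        (η := (Sum.inr v : Place K)) (w := (Sum.inr w : Place K)) (fun h ↦ hwv (Sum.inr_injective h)),
      Submodule.mem_bot, sub_eq_zero] at hη
    exact hη
  have hloc0 : ∀ w : HeightOneSpectrum (𝓞 K), w ∈ S → w ≠ v → w ∉ S₀ →
      loc S (bigRep (κ.liftUnramifiedOutside S hS) ρ₀) (Sum.inr w) 1 (oneCocycleClass _ c) = 0 := by
    intro w hwS hwv hw
    rw [hcomp w hwS hwv]
    exact dif_neg hw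
  refine ⟨F (oneCocycleClass _ c), ?_, fun w hwS hwv hw σ ↦ ?_, fun w hw i hi ↦ ?_⟩
  · -- unramified outside `S₀ ∪ {w ∣ p}`
    rw [mem_unramifiedOutside_iff]
    intro w hwS₀ hpw σ
    by_cases hwS : w ∈ S
    · have hwv : w ≠ v := fun h ↦ hpw (h ▸ hv)
      exact awayKer_le_unramifiedKer κ.kerSubgroup w
        (conjH1_shapiroDescent_mem_awayKer_of_loc_eq_zero S hS κ ρ₀ ψ hψ hA hF w c
          (hloc0 w hwS hwv fun h ↦ hwS₀ (Finset.mem_coe.mpr h)) σ)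
    · exact conjH1_shapiroDescent_mem_unramifiedKer_of_not_mem S hS κ ρ₀ ψ hψ hF hwS c σ
  · -- locally trivial above the non-target places `w ∈ S ∖ ({v} ∪ S₀)`
    exact conjH1_shapiroDescent_mem_awayKer_of_loc_eq_zero S hS κ ρ₀ ψ hψ hA hF w c (hloc0 w hwS hwv hw) σ
  · -- the local components at `S₀` are the evaluation classes
    have hcc' : loc S (bigRep (κ.liftUnramifiedOutside S hS) ρ₀) (Sum.inr w) 1 (oneCocycleClass _ c) =
        oneCocycleClass _ (c' w hw) := by
      rw [hcomp w (hS₀S w hw) (hS₀v w hw)]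
      exact dif_pos hw
    rw [← hζ w i]
    refine resOfLe_conjH1_shapiroDescent_eq S hS κ ρ₀ ψ hψ hF w (σrep w i) c (c' w hw) hcc' (ζ w i)
      fun x τ hτ ↦ ?_
    rw [hσrep w hw i hi]
    exact hc' w hw i hi x τ hτ

end SurOfSUR

end Summit.BirchSwinnertonDyer.BirchSwinnertonDyer.Theorems.AcTwistDeformation

end
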